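import Summits.QuantumFields.YangMills.Theorems.UnitScaleTiltProp7MassiveDivergenceSupDoor
import HarnessLib

/-!
# Route `UnitScaleTilt`, crux K1 «MinimiserStabilityRegPr» (stmt-QuantumFields-19200), EX row (5) `h3` (STOREY H), H-ROAD pipeline (ii) H2-LOC — DOOR-Q, THE DOOR FOR A GENERAL SITE TERM:
# **THE SUP OF A SOLUTION OF `Δ^η_{U₀}u + q = D*_{U₀}x` AT A PRINTED-REGULAR BACKGROUND FROM THE CURVED INTERIOR η-½-HÖLDER LETTER (UPSTAIRS, IN THE LOCAL GAUGE) AND AN `L²` BALL ROW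
# CONSUMED DOWNSTAIRS AT THE MEMBER'S OWN `(U₀, u)`** — one mechanism for the two sup letters `hWsup` (`q := 1•w`, ★CHAIR №62) and `hUsup` (`q := a•T(ι(Q″u))`, the LOD penalty, ★CHAIR №63 (2)
# «ONE mechanism, two instances»; cst-p1 g38 18:01:57Z «DOOR-LOD is px5 g16's word»; px21 g17's (β-L²) row = the `hL2` socket; px13 g17's ✓`hPen_of_regPr` = the `hq` socket).

Cell `ym3-torus` (HUMAN RULING D-0037; rung R3 = SU(2) YM₃ on T³ — NOT d = 4, NOT infinite volume, NOT a mass gap, NOT Clay).  Width seat `ym3-torus-px5` (gen 16);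
`--supports stmt-QuantumFields-19200 --as helper`; count-neutral; THEOREMS ONLY (0 `def`, 0 `sorry`, default heartbeats).

WHY A SECOND DOOR.  ✓`Prop7MassiveDivergenceSupDoor.hWsup_of_hHlocV` consumes its Agmon row UPSTAIRS, at the gauged background on the cover — legal for (A-ROW), which holds at ANY background.
The LOD resolvent `u = G(D*_{U₀}x)` has no typed naturality under cover∕gauge (and none is wanted: px19 g16 LOCATE §4), so its `L²` row (px21 g17's (β-L²), at `U₀` under `RegPr`) must be
consumed DOWNSTAIRS.  DOOR-Q does exactly that: the Hölder letter `hHlocV` is applied UPSTAIRS on the `L³`-fold cover in the axial gauge at a lift `ct` of the argmax `y₀` of `‖u‖` (room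
✓`room_cover_three`, δ-row ✓`norm_bgOfCfg_gaugeAct_axialT_sub_one_le_cover`, isometries ✓`exists_adIsometries_pointwise`), the resulting pointwise LOWER bound `‖ũ(z)‖ ≥ M − (M+X)∕8` on the
small cover ball is carried DOWN to the member ball point by point along DISTANCE-PRESERVING LIFTS (§1, the `tdist ∘ siteEquiv` reading of ✓`CoverSites.exists_lift_distSite_eq`), and the ball
count (✓`pow_le_card_ball`, room `ℓ + 1 ≤ 2L^{m+K}` at EVERY member) and the `L²` row are used DOWNSTAIRS.  [Balaban1985BackgroundPropagators] Thm 3.1 (3.46)-type sup bound; K-free.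

WHAT IS PROVED (ns `Summit.QuantumFields.YangMills.Theorems.Prop7DivergenceSupDoorQ`).
* §1 ★ `exists_lift_tdist_eq` — every site downstairs has a lift at the SAME fine sup-distance from a given cover site; `ell_succ_le_period` — `L^{K−n} + 1 ≤ 2L^{m+K}` (every `n K`).
* §2 ★★ `exists_cover_gauge_lift_q` — the lift-and-gauge package of ✓`exists_cover_gauge_lift` for a GENERAL site term `q`: `(Ṽ, ũ, q̃, f̃, ct)` on `F.cover 3` with
  `Δ^η_{Ṽ}ũ + q̃ = D*_{Ṽ}f̃`, the pointwise dictionary `‖ũ z‖ = ‖u(π z)‖`, `‖q̃ z‖ = ‖q(π z)‖`, `‖f̃ p‖ ∈ {‖x b‖}`, `π(ẽ ct) = y₀`, the δ-row `48ε₀η` on the `12ℓ+4` ball, and §1's lifts.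
* §3 ★ `sup_le_of_lower_bound_L2` — the member arithmetic (ball count + `L²` row against a pointwise lower bound on the `ℓ∕a²` ball): `M ≤ (2a³√C_A + 1)·X`.
* §4 ★★ `lower_bound_of_hHlocV_q` — the pointwise lower bound `‖u‖ ≥ M − (M+X)∕8` DOWNSTAIRS on the `ℓ∕a²` ball from `hHlocV` UPSTAIRS; ★★★ **`sup_le_of_hHlocV_q`** — THE DOOR-Q: from the letter `hHlocV Ch θ₀` (px19 g16 text 857ccd79b0071bdc VERBATIM), `RegPr F n K ε₀ U₀` with `0 ≤ ε₀ ≤ θ₀∕48`, a solution of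
  `Δ^η_{U₀}u + q = D*_{U₀}x` with `‖x‖_∞ ≤ X`, a RELATIVE sup letter for `q` (`‖q‖_∞ ≤ Cq·G_b` whenever `‖u‖_∞ ≤ G_b` — px13's `hPen` shape) and the `L²` ball row
  `Σ_{tdist(y₀,·) ≤ ℓ} ‖u‖² ≤ C_A·ℓ³·X²` at every centre DOWNSTAIRS: **`‖u(y)‖ ≤ (2(8Ch(1+Cq)+1)³√C_A + 1)·X`** at every site.
HYP-SAT (★★OWNER RULING №42).  `hHlocV` TRUE for arbitrary `V` (px19 ✓C1–C4, C5b signed); `hq` and `hL2` are real-inequality schemas about the displayed `u, q, x` (inhabited at `u = q = 0, x = 0`);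
`RegPr` = the EX face's standing hypothesis; the conclusion is a GLOBAL sup, the letters are a LOCAL modulus, a RELATIVE size and a LOCAL `L²` mass — nothing conclusion-shaped is assumed.
HONEST SCOPE.  A knit over landed rows; `hHlocV`, `hPen`, (β-L²), `hUsup`, H2, `h3`, norm_G, EX, 19200 and the rung are NOT proved here; the Yang–Mills mass gap is NOT proved.

References: T. Bałaban, CMP **99** (1985) 389–434 [Balaban1985BackgroundPropagators] (Thm 3.1 (3.42)–(3.47) pp.397–399, p.399 L1–3, (3.35) p.396, (3.23) p.394); CMP **96** (1984)
223–250 [Balaban1984PropagatorsII] (Lemma 2.1 (2.61)–(2.63) p.234); CMP **95** (1984) 17–40 [Balaban1984PropagatorsI] ((1.110) p.35); CMP **109** (1987) 249–301 [Balaban1987RG1]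
((0.1)–(0.3) pp.251–252).
-/

set_option autoImplicit false

noncomputable section

open scoped InnerProductSpace ComplexConjugate BigOperators Matrix.Norms.L2Operator

namespace Summit.QuantumFields.YangMills.Theorems.Prop7DivergenceSupDoorQ

open Literature.MathematicalPhysics.QuantumFieldTheory.Balaban1983to89
open Literature.MathematicalPhysics.QuantumFieldTheory.Balaban1983to89.T3ContinuumYM3Torus
open B4Sect5Torus (TSite tdist tdist_nonneg)
open B9SectCLatticeCarrier (Bond)
open B9Eq311L2Pairing (WL2)
open B11Eq103H1Complex (SiteL2K BondL2K)
open B10Eq27TorusAxialLog (axialT rel rel_apply)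
open T3PrintedRegularMinimiser (RegPr)
open T3SectALandauChart (eta eta_pos)
open Summit.QuantumFields.YangMills.Theorems.Prop7SectET3Transport (periodsT3 siteEquiv bondEquiv bgOfCfg)
open Summit.QuantumFields.YangMills.Theorems.Prop7SectET3HilbertLetters (W₂ toL2 toL2S DstarL2 covLapSite toL2_apply toL2S_apply)
open Summit.QuantumFields.YangMills.Theorems.CoverSites
open Summit.QuantumFields.YangMills.Theorems.AxialGaugeChartGlue (tdist_siteEquiv)
open Summit.QuantumFields.YangMills.Theorems.Prop7CoverHilbertPullback (covLapSite_cover DstarL2_cover')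
open Summit.QuantumFields.YangMills.Theorems.Prop7GaugeCovariancePointwise (exists_adIsometries_pointwise memberEquation_gaugeAct)
open Summit.QuantumFields.YangMills.Theorems.Prop7LocalAxialGaugeSmallField (norm_bgOfCfg_gaugeAct_axialT_sub_one_le_cover)
open Summit.QuantumFields.YangMills.Theorems.Prop7PoissonGradientDecayAllMembers (tdist_siteEquiv_proj_le)
open Summit.QuantumFields.YangMills.Theorems.Prop7MassiveDivergenceSupDoor (pow_le_card_ball)

/-! ## §1 Distance-preserving lifts; the member's own room -/

section Lifts

variable (F : T3Family) (jc n K : ℕ)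

/-- ★ **THE FINE SUP-DISTANCE DOWNSTAIRS IS ATTAINED ON A LIFT** (✓`CoverSites.exists_lift_distSite_eq` read in the route's `tdist ∘ siteEquiv` currency ✓`tdist_siteEquiv`): for every cover
site `xt` and every site `y` downstairs there is a lift `yt` of `y` with `tdist (ẽ xt) (ẽ yt) = tdist (e(π xt)) (e y)` (lift each coordinate of the relative position by its minimal representative).
[cite: Balaban1984PropagatorsI, (1.110) p.35] -/
theorem exists_lift_tdist_eq (xt : Site (cover (F.P K) jc) 0) (y : Site (F.P K) 0) :
    ∃ yt : Site (cover (F.P K) jc) 0, proj (F.P K) jc 0 yt = y ∧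
      tdist (periodsT3 (F.cover jc) K) (siteEquiv (F.cover jc) K xt) (siteEquiv (F.cover jc) K yt)
        = tdist (periodsT3 F K) (siteEquiv F K (proj (F.P K) jc 0 xt)) (siteEquiv F K y) := by
  -- the relative position downstairs, as minimal integers
  let r : Fin (F.P K).d → ℤ := fun μ => (y μ - proj (F.P K) jc 0 xt μ).valMinAbs
  have hr : ∀ μ, ((r μ : ℤ) : ZMod ((F.P K).sitesPerDir 0)) = y μ - proj (F.P K) jc 0 xt μ := fun μ => ZMod.coe_valMinAbs _
  refine ⟨fun μ => xt μ + (r μ : ZMod ((cover (F.P K) jc).sitesPerDir 0)), ?_, ?_⟩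
  · funext μ
    rw [proj_apply, map_add, map_intCast, ← proj_apply, hr, add_sub_cancel]
  · rw [tdist_siteEquiv, tdist_siteEquiv]
    refine congrArg (fun m : ℕ => (m : ℝ)) (Finset.sup_congr rfl fun μ _ => ?_)
    rw [rel_apply, rel_apply]
    show ((xt μ + (r μ : ZMod ((cover (F.P K) jc).sitesPerDir 0)) - xt μ).valMinAbs).natAbs = ((y μ - proj (F.P K) jc 0 xt μ).valMinAbs).natAbs
    rw [add_sub_cancel_left]
    exact natAbs_valMinAbs_intCast_of_le (r μ) ((ZMod.natAbs_valMinAbs_le _).trans (Nat.div_le_div_right (sitesPerDir_le (F.P K) jc 0)))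

omit jc in
/-- **EVERY MEMBER HAS THE SMALL ROOM `ℓ + 1 ≤ period`**: `L^{K−n} + 1 ≤ 2L^{m+K} = sitesPerDir 0` (since `m ≥ 1`, `L ≥ 3`) — the no-wrap condition of the ball count ✓`pow_le_card_ball` at
radii `≤ ℓ` downstairs. [cite: Balaban1985UV3, (1)-(3) p.256] -/
theorem ell_succ_le_period : ∀ i, (F.L : ℝ) ^ (K - n) + 1 ≤ (periodsT3 F K i : ℝ) := by
  intro i
  have hL1 : 1 ≤ F.L := le_of_lt F.hL.2
  have h1 : F.L ^ (K - n) ≤ F.L ^ (F.m + K - 0) := Nat.pow_le_pow_right hL1 (by omega)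
  have h2 : 1 ≤ F.L ^ (F.m + K - 0) := Nat.one_le_pow _ _ hL1
  have h3 : F.L ^ (K - n) + 1 ≤ periodsT3 F K i := by
    show F.L ^ (K - n) + 1 ≤ 2 * F.L ^ (F.m + K - 0)
    omega
  exact_mod_cast h3

end Lifts

/-! ## §2 The lift-and-gauge package for a general site term `q` -/

section Lift

variable (F : T3Family) (n K : ℕ) (c₀ : ℝ) [Fact (0 < c₀)]

/-- ★★ **THE LIFT-AND-GAUGE PACKAGE, GENERAL `q`.**  For `RegPr F n K ε₀ U₀` (`0 ≤ ε₀`), a solution `(u, q, x)` of `Δ^η_{U₀}u + q = D*_{U₀}x` and a site `y₀`: on `F.cover 3` there are a background `Ṽ`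
(the lift `U₀ ∘ π♭` in the cover's axial gauge at a lift `ct` of `y₀`), fields `ũ, q̃, f̃` with `Δ^η_{Ṽ}ũ + q̃ = D*_{Ṽ}f̃` (✓`covLapSite_cover`, ✓`DstarL2_cover'`, ✓`memberEquation_gaugeAct`),
the pointwise dictionary `‖ũ(z)‖ = ‖u(π z)‖`, `‖q̃(z)‖ = ‖q(π z)‖` (`π := e ∘ proj ∘ ẽ⁻¹`), `‖f̃(p)‖ ∈ {‖x(b)‖}`, `π(ẽ ct) = y₀`, the δ-row `‖Ṽ(z, μ) − 1‖ ≤ 48ε₀η` on the `12ℓ+4` ball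
about `ẽ ct`, and for every `y` downstairs a lift `z` with `π z = y` and `tdist (ẽ ct) z = tdist y₀ y` (§1).
[cite: Balaban1985BackgroundPropagators, (3.35) p.396, p.393, (3.23) p.394; Balaban1985Averaging, pp.24-25; Balaban1984PropagatorsI, (1.110) p.35] -/
theorem exists_cover_gauge_lift_q {ε₀ : ℝ} (hε₀ : 0 ≤ ε₀) (U₀ : GaugeField (F.P K) 0 (Matrix.specialUnitaryGroup (Fin 2) ℂ)) (hreg : RegPr F n K ε₀ U₀)
    (u q : SiteL2K ℂ 3 (periodsT3 F K) c₀ W₂) (x : BondL2K ℂ 3 (periodsT3 F K) c₀ W₂)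
    (h : covLapSite F n K c₀ U₀ u + q = DstarL2 F n K c₀ U₀ x) (y₀ : TSite 3 (periodsT3 F K)) :
    ∃ (V : GaugeField ((F.cover 3).P K) 0 (Matrix.specialUnitaryGroup (Fin 2) ℂ)) (ut qt : SiteL2K ℂ 3 (periodsT3 (F.cover 3) K) c₀ W₂)
      (ft : BondL2K ℂ 3 (periodsT3 (F.cover 3) K) c₀ W₂) (ct : Site ((F.cover 3).P K) 0),
      covLapSite (F.cover 3) n K c₀ V ut + qt = DstarL2 (F.cover 3) n K c₀ V ft ∧
      (∀ z : TSite 3 (periodsT3 (F.cover 3) K), ‖WL2.equiv ℂ (fun _ : TSite 3 (periodsT3 (F.cover 3) K) => c₀) W₂ ut z‖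
        = ‖WL2.equiv ℂ (fun _ : TSite 3 (periodsT3 F K) => c₀) W₂ u (siteEquiv F K (proj (F.P K) 3 0 ((siteEquiv (F.cover 3) K).symm z)))‖) ∧
      (∀ z : TSite 3 (periodsT3 (F.cover 3) K), ‖WL2.equiv ℂ (fun _ : TSite 3 (periodsT3 (F.cover 3) K) => c₀) W₂ qt z‖
        = ‖WL2.equiv ℂ (fun _ : TSite 3 (periodsT3 F K) => c₀) W₂ q (siteEquiv F K (proj (F.P K) 3 0 ((siteEquiv (F.cover 3) K).symm z)))‖) ∧
      (∀ p : Bond 3 (periodsT3 (F.cover 3) K), ∃ b : Bond 3 (periodsT3 F K),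
        ‖WL2.equiv ℂ (fun _ : Bond 3 (periodsT3 (F.cover 3) K) => c₀) W₂ ft p‖ = ‖WL2.equiv ℂ (fun _ : Bond 3 (periodsT3 F K) => c₀) W₂ x b‖) ∧
      siteEquiv F K (proj (F.P K) 3 0 ct) = y₀ ∧
      (∀ (z : TSite 3 (periodsT3 (F.cover 3) K)) (μ : Fin 3), tdist (periodsT3 (F.cover 3) K) (siteEquiv (F.cover 3) K ct) z ≤ 12 * (F.L : ℝ) ^ (K - n) + 4 →
        ‖((bgOfCfg (F.cover 3) K V (z, μ) : (Matrix (Fin 2) (Fin 2) ℂ)ˣ) : Matrix (Fin 2) (Fin 2) ℂ) - 1‖ ≤ 48 * ε₀ * eta F n K) ∧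
      (∀ y : TSite 3 (periodsT3 F K), ∃ z : TSite 3 (periodsT3 (F.cover 3) K), siteEquiv F K (proj (F.P K) 3 0 ((siteEquiv (F.cover 3) K).symm z)) = y ∧
        tdist (periodsT3 (F.cover 3) K) (siteEquiv (F.cover 3) K ct) z = tdist (periodsT3 F K) y₀ y) := by
  classical
  -- the lifted background and a lift of `y₀`
  set Ut : GaugeField ((F.cover 3).P K) 0 (Matrix.specialUnitaryGroup (Fin 2) ℂ) := U₀ ∘ projBond (F.P K) 3 0 with hUt
  obtain ⟨ct, hct⟩ := proj_surjective (F.P K) 3 0 ((siteEquiv F K).symm y₀)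
  have hcty : siteEquiv F K (proj (F.P K) 3 0 ct) = y₀ := by rw [hct, Equiv.apply_symm_apply]
  -- the lifted fields
  set l : Site (F.P K) 0 → Matrix (Fin 2) (Fin 2) ℂ := (toL2S F K c₀).symm u with hl
  set lq : Site (F.P K) 0 → Matrix (Fin 2) (Fin 2) ℂ := (toL2S F K c₀).symm q with hlq
  set Xf : PBond (F.P K) 0 → Matrix (Fin 2) (Fin 2) ℂ := (toL2 F K c₀).symm x with hXf
  have hul : toL2S F K c₀ l = u := (toL2S F K c₀).apply_symm_apply u
  have hqlq : toL2S F K c₀ lq = q := (toL2S F K c₀).apply_symm_apply q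
  have hxX : toL2 F K c₀ Xf = x := (toL2 F K c₀).apply_symm_apply x
  set ut : SiteL2K ℂ 3 (periodsT3 (F.cover 3) K) c₀ W₂ := toL2S (F.cover 3) K c₀ (l ∘ proj (F.P K) 3 0) with hut
  set qt : SiteL2K ℂ 3 (periodsT3 (F.cover 3) K) c₀ W₂ := toL2S (F.cover 3) K c₀ (lq ∘ proj (F.P K) 3 0) with hqt
  set xt : BondL2K ℂ 3 (periodsT3 (F.cover 3) K) c₀ W₂ := toL2 (F.cover 3) K c₀ (Xf ∘ projBond (F.P K) 3 0) with hxt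
  -- the lifted equation
  have key : (toL2S F K c₀).symm (covLapSite F n K c₀ U₀ u) + lq = (toL2S F K c₀).symm (DstarL2 F n K c₀ U₀ x) := by
    rw [hlq, ← map_add, h]
  have hteq : covLapSite (F.cover 3) n K c₀ Ut ut + qt = DstarL2 (F.cover 3) n K c₀ Ut xt := by
    have hΔ := covLapSite_cover F 3 n K c₀ U₀ l
    rw [hul] at hΔ
    have hD := DstarL2_cover' F 3 n K c₀ U₀ Xf
    rw [hxX] at hD
    rw [hUt, hut, hΔ, hqt, hxt, hD, ← map_add]
    congr 1
    funext z
    simpa only [Pi.add_apply, Function.comp_apply] using congr_fun key (proj (F.P K) 3 0 z)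
  -- the pointwise values of the lifts
  have hut_apply : ∀ z : TSite 3 (periodsT3 (F.cover 3) K),
      WL2.equiv ℂ (fun _ : TSite 3 (periodsT3 (F.cover 3) K) => c₀) W₂ ut z
        = WL2.equiv ℂ (fun _ : TSite 3 (periodsT3 F K) => c₀) W₂ u (siteEquiv F K (proj (F.P K) 3 0 ((siteEquiv (F.cover 3) K).symm z))) := by
    intro z
    rw [hut, toL2S_apply, Function.comp_apply, ← hul, toL2S_apply, Equiv.symm_apply_apply]
  have hqt_apply : ∀ z : TSite 3 (periodsT3 (F.cover 3) K),
      WL2.equiv ℂ (fun _ : TSite 3 (periodsT3 (F.cover 3) K) => c₀) W₂ qt z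
        = WL2.equiv ℂ (fun _ : TSite 3 (periodsT3 F K) => c₀) W₂ q (siteEquiv F K (proj (F.P K) 3 0 ((siteEquiv (F.cover 3) K).symm z))) := by
    intro z
    rw [hqt, toL2S_apply, Function.comp_apply, ← hqlq, toL2S_apply, Equiv.symm_apply_apply]
  have hxt_apply : ∀ p : Bond 3 (periodsT3 (F.cover 3) K),
      WL2.equiv ℂ (fun _ : Bond 3 (periodsT3 (F.cover 3) K) => c₀) W₂ xt p
        = WL2.equiv ℂ (fun _ : Bond 3 (periodsT3 F K) => c₀) W₂ x (bondEquiv F K (projBond (F.P K) 3 0 ((bondEquiv (F.cover 3) K).symm p))) := by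
    intro p
    rw [hxt, toL2_apply, Function.comp_apply, ← hxX, toL2_apply, Equiv.symm_apply_apply]
  -- the local gauge at `ct`
  set σ : GaugeTransf ((F.cover 3).P K) 0 (Matrix.specialUnitaryGroup (Fin 2) ℂ) := axialT Ut ct with hσ
  obtain ⟨Φ, Ψ, -, -, hΦpt, hΨpt, hU⟩ := exists_adIsometries_pointwise (F.cover 3) n K c₀ σ
  obtain ⟨-, hDstar, hΔc, -, -, -⟩ := hU Ut
  have hgeq := memberEquation_gaugeAct (F.cover 3) n K c₀ σ Ut Φ Ψ hDstar hΔc hteq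
  refine ⟨GaugeField.gaugeAct σ Ut, Φ ut, Φ qt, Ψ xt, ct, hgeq, fun z => ?_, fun z => ?_,
    fun p => ⟨bondEquiv F K (projBond (F.P K) 3 0 ((bondEquiv (F.cover 3) K).symm p)), ?_⟩, hcty, fun z μ hz => ?_, fun y => ?_⟩
  · rw [hΦpt, hut_apply]
  · rw [hΦpt, hqt_apply]
  · rw [hΨpt, hxt_apply]
  · rw [hσ, hUt]
    exact norm_bgOfCfg_gaugeAct_axialT_sub_one_le_cover F n K hε₀ U₀ hreg ct z μ hz
  · obtain ⟨yt, hyt, hd⟩ := exists_lift_tdist_eq F 3 K ct ((siteEquiv F K).symm y)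
    refine ⟨siteEquiv (F.cover 3) K yt, ?_, ?_⟩
    · rw [Equiv.symm_apply_apply, hyt, Equiv.apply_symm_apply]
    · rw [hd, hcty, Equiv.apply_symm_apply]

end Lift

/-! ## §3 The member arithmetic: ball count and `L²` row against a pointwise lower bound -/

section Arithmetic

variable (F : T3Family) (n K : ℕ) (c₀ : ℝ) [Fact (0 < c₀)]

omit [Fact (0 < c₀)] in
/-- ★ **THE BOOTSTRAP ARITHMETIC AT ONE MEMBER** (no letters): if `‖u‖ ≥ M − (M + X)∕8` on the member ball of radius `ℓ∕a²` about `y₀` (`a ≥ 1`, `X ≥ 0`) and the `L²` ball row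
`Σ_{tdist(y₀,·) ≤ ℓ} ‖u‖² ≤ C_A·ℓ³·X²` holds, then `M ≤ (2a³√C_A + 1)·X` — ball count ✓`pow_le_card_ball` (room `ell_succ_le_period`): `(ℓ∕a²)³(M − (M+X)∕8)² ≤ C_Aℓ³X²` unless `7M ≤ X`.
[cite: Balaban1985BackgroundPropagators, Thm 3.1 (3.46) p.398, p.399 L1-3] -/
theorem sup_le_of_lower_bound_L2 (u : SiteL2K ℂ 3 (periodsT3 F K) c₀ W₂) (y₀ : TSite 3 (periodsT3 F K)) (M X C_A a : ℝ)
    (hX : 0 ≤ X) (hCA : 0 ≤ C_A) (ha1 : 1 ≤ a)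
    (hlow : ∀ y, tdist (periodsT3 F K) y₀ y ≤ (F.L : ℝ) ^ (K - n) / a ^ 2 → M - (M + X) / 8 ≤ ‖WL2.equiv ℂ (fun _ : TSite 3 (periodsT3 F K) => c₀) W₂ u y‖)
    (hL2 : ∑ y ∈ Finset.univ.filter (fun y => tdist (periodsT3 F K) y₀ y ≤ (F.L : ℝ) ^ (K - n)),
          ‖WL2.equiv ℂ (fun _ : TSite 3 (periodsT3 F K) => c₀) W₂ u y‖ ^ 2 ≤ C_A * ((F.L : ℝ) ^ (K - n)) ^ 3 * X ^ 2) :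
    M ≤ (2 * a ^ 3 * Real.sqrt C_A + 1) * X := by
  classical
  set ℓ : ℝ := (F.L : ℝ) ^ (K - n) with hℓ
  have hL1 : (1 : ℝ) < (F.L : ℝ) := by exact_mod_cast F.hL.2
  have hℓpos : 0 < ℓ := pow_pos (lt_trans zero_lt_one hL1) _
  have ha0 : 0 < a := lt_of_lt_of_le zero_lt_one ha1
  set r : ℝ := ℓ / a ^ 2 with hr
  have hr0 : 0 ≤ r := by positivity
  have hrℓ : r ≤ ℓ := by
    rw [hr, div_le_iff₀ (by positivity)]
    exact le_mul_of_one_le_right hℓpos.le (one_le_pow₀ ha1)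
  set m₀ : ℝ := M - (M + X) / 8 with hm₀
  -- the member ball and its `L²` mass
  set S := Finset.univ.filter (fun y : TSite 3 (periodsT3 F K) => tdist (periodsT3 F K) y₀ y ≤ r) with hS
  have hSsub : S ⊆ Finset.univ.filter (fun y => tdist (periodsT3 F K) y₀ y ≤ (F.L : ℝ) ^ (K - n)) :=
    Finset.monotone_filter_right _ fun y _ hy => hy.trans hrℓ
  have hsumS : ∑ y ∈ S, ‖WL2.equiv ℂ (fun _ : TSite 3 (periodsT3 F K) => c₀) W₂ u y‖ ^ 2 ≤ C_A * ℓ ^ 3 * X ^ 2 :=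
    (Finset.sum_le_sum_of_subset_of_nonneg hSsub fun _ _ _ => sq_nonneg _).trans hL2
  have hcard : r ^ 3 ≤ (S.card : ℝ) := pow_le_card_ball y₀ hr0 fun i => by linarith [ell_succ_le_period F n K i]
  have hA3 : 0 ≤ a ^ 3 * Real.sqrt C_A * X := by positivity
  by_cases hm : m₀ ≤ 0
  · -- `7M ≤ X`
    have h7 : M ≤ X / 7 := by rw [hm₀] at hm; linarith
    have : X / 7 ≤ (2 * a ^ 3 * Real.sqrt C_A + 1) * X := by linarith [hA3]
    exact h7.trans this
  · rw [not_le] at hm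
    have h5 : (S.card : ℝ) * m₀ ^ 2 ≤ ∑ y ∈ S, ‖WL2.equiv ℂ (fun _ : TSite 3 (periodsT3 F K) => c₀) W₂ u y‖ ^ 2 := by
      have := Finset.card_nsmul_le_sum S (fun y => ‖WL2.equiv ℂ (fun _ : TSite 3 (periodsT3 F K) => c₀) W₂ u y‖ ^ 2) (m₀ ^ 2)
        fun y hy => pow_le_pow_left₀ hm.le (hlow y (Finset.mem_filter.mp hy).2) 2
      rwa [nsmul_eq_mul] at this
    have h6 : r ^ 3 * m₀ ^ 2 ≤ C_A * ℓ ^ 3 * X ^ 2 := (mul_le_mul_of_nonneg_right hcard (sq_nonneg _)).trans (h5.trans hsumS)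
    have h7 : m₀ ^ 2 ≤ (a ^ 3 * Real.sqrt C_A * X) ^ 2 := by
      have hr3 : r ^ 3 = ℓ ^ 3 / a ^ 6 := by rw [hr, div_pow]; ring
      rw [hr3, div_mul_eq_mul_div, div_le_iff₀ (by positivity)] at h6
      have hℓ3 : 0 < ℓ ^ 3 := by positivity
      have h6' : ℓ ^ 3 * m₀ ^ 2 ≤ ℓ ^ 3 * (a ^ 6 * C_A * X ^ 2) := by linarith [h6]
      have h8 := le_of_mul_le_mul_left h6' hℓ3
      calc m₀ ^ 2 ≤ a ^ 6 * C_A * X ^ 2 := h8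
        _ = (a ^ 3 * Real.sqrt C_A * X) ^ 2 := by rw [mul_pow, mul_pow, Real.sq_sqrt hCA, ← pow_mul]
    have h8 : m₀ ≤ a ^ 3 * Real.sqrt C_A * X := by
      have := Real.sqrt_le_sqrt h7
      rwa [Real.sqrt_sq hm.le, Real.sqrt_sq hA3] at this
    have hMm : M = (8 * m₀ + X) / 7 := by rw [hm₀]; ring
    rw [hMm]
    linarith [h8, hX, hA3]

end Arithmetic

/-! ## §4 ★★★ DOOR-Q -/

section Door

variable (Ch θ₀ : ℝ) (hCh : 0 ≤ Ch)
  (hHlocV : ∀ (F : T3Family) (n K : ℕ) (c₀ : ℝ) [Fact (0 < c₀)] (V : GaugeField (F.P K) 0 (Matrix.specialUnitaryGroup (Fin 2) ℂ))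
      (u q : SiteL2K ℂ 3 (periodsT3 F K) c₀ W₂) (f : BondL2K ℂ 3 (periodsT3 F K) c₀ W₂) (x : TSite 3 (periodsT3 F K)) (Mu Mf Mq δ : ℝ),
      0 ≤ Mu → 0 ≤ Mf → 0 ≤ Mq → 0 ≤ δ → (F.L : ℝ) ^ (K - n) * δ ≤ θ₀ →
      covLapSite F n K c₀ V u + q = DstarL2 F n K c₀ V f →
      (∀ y, tdist (periodsT3 F K) x y ≤ 4 * (F.L : ℝ) ^ (K - n) + 1 → ‖WL2.equiv ℂ (fun _ : TSite 3 (periodsT3 F K) => c₀) W₂ u y‖ ≤ Mu) →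
      (∀ (y : TSite 3 (periodsT3 F K)) (μ : Fin 3), tdist (periodsT3 F K) x y ≤ 4 * (F.L : ℝ) ^ (K - n) + 1 →
        ‖WL2.equiv ℂ (fun _ : Bond 3 (periodsT3 F K) => c₀) W₂ f (y, μ)‖ ≤ Mf) →
      (∀ y, tdist (periodsT3 F K) x y ≤ 4 * (F.L : ℝ) ^ (K - n) + 1 → ‖WL2.equiv ℂ (fun _ : TSite 3 (periodsT3 F K) => c₀) W₂ q y‖ ≤ Mq) →
      (∀ (y : TSite 3 (periodsT3 F K)) (μ : Fin 3), tdist (periodsT3 F K) x y ≤ 4 * (F.L : ℝ) ^ (K - n) + 1 →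
        ‖((bgOfCfg F K V (y, μ) : (Matrix (Fin 2) (Fin 2) ℂ)ˣ) : Matrix (Fin 2) (Fin 2) ℂ) - 1‖ ≤ δ) →
      ∀ x' : TSite 3 (periodsT3 F K), tdist (periodsT3 F K) x x' ≤ (F.L : ℝ) ^ (K - n) →
        ‖WL2.equiv ℂ (fun _ : TSite 3 (periodsT3 F K) => c₀) W₂ u x' - WL2.equiv ℂ (fun _ : TSite 3 (periodsT3 F K) => c₀) W₂ u x‖
          ≤ Ch * (Mu + Mf + Mq) * (tdist (periodsT3 F K) x x' / ((F.L : ℝ) ^ (K - n))) ^ ((1 : ℝ) / 2))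
  (F : T3Family) (n K : ℕ) (c₀ : ℝ) [Fact (0 < c₀)]

include hCh hHlocV in
/-- ★★ **THE POINTWISE LOWER BOUND DOWNSTAIRS FROM THE HÖLDER LETTER UPSTAIRS.**  For `RegPr F n K ε₀ U₀` (`0 ≤ ε₀ ≤ θ₀∕48`), a solution `(u, q, x)` of `Δ^η_{U₀}u + q = D*_{U₀}x` with
`‖u‖ ≤ M = ‖u(y₀)‖`, `‖x‖ ≤ X`, `‖q‖ ≤ Cq·M`: on the member ball of radius `ℓ∕a²` about `y₀`, `a := 8Ch(1+Cq)+1`, **`‖u(y)‖ ≥ M − (M + X)∕8`** — §2 at `y₀`, `hHlocV` on the cover at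
`(Mu, Mf, Mq, δ) := (M, X, Cq·M, 48ε₀η)` (`ℓ·48ε₀η = 48ε₀ ≤ θ₀`), `(t∕ℓ)^{1∕2} ≤ 1∕a` on `t ≤ ℓ∕a²`, carried down along §1's distance-preserving lifts.
[cite: Balaban1985BackgroundPropagators, Thm 3.1 (3.43) p.398, (3.35) p.396; Balaban1984PropagatorsI, (1.110) p.35] -/
theorem lower_bound_of_hHlocV_q {ε₀ : ℝ} (hε₀ : 0 ≤ ε₀) (hεθ : ε₀ ≤ θ₀ / 48)
    (U₀ : GaugeField (F.P K) 0 (Matrix.specialUnitaryGroup (Fin 2) ℂ)) (hreg : RegPr F n K ε₀ U₀)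
    (u q : SiteL2K ℂ 3 (periodsT3 F K) c₀ W₂) (x : BondL2K ℂ 3 (periodsT3 F K) c₀ W₂) (y₀ : TSite 3 (periodsT3 F K)) (M X Cq : ℝ) (hX : 0 ≤ X) (hCq : 0 ≤ Cq)
    (h : covLapSite F n K c₀ U₀ u + q = DstarL2 F n K c₀ U₀ x)
    (huM : ∀ y, ‖WL2.equiv ℂ (fun _ : TSite 3 (periodsT3 F K) => c₀) W₂ u y‖ ≤ M) (hy₀ : ‖WL2.equiv ℂ (fun _ : TSite 3 (periodsT3 F K) => c₀) W₂ u y₀‖ = M)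
    (hx : ∀ b, ‖WL2.equiv ℂ (fun _ : Bond 3 (periodsT3 F K) => c₀) W₂ x b‖ ≤ X)
    (hqM : ∀ y, ‖WL2.equiv ℂ (fun _ : TSite 3 (periodsT3 F K) => c₀) W₂ q y‖ ≤ Cq * M) :
    ∀ y, tdist (periodsT3 F K) y₀ y ≤ (F.L : ℝ) ^ (K - n) / (8 * Ch * (1 + Cq) + 1) ^ 2 →
      M - (M + X) / 8 ≤ ‖WL2.equiv ℂ (fun _ : TSite 3 (periodsT3 F K) => c₀) W₂ u y‖ := by
  intro y' hy'
  have hM0 : 0 ≤ M := hy₀ ▸ norm_nonneg _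
  -- lift and gauge
  obtain ⟨V, ut, qt, ft, ct, heq, hut, hqt, hft, hcty, hδ, hlift⟩ := exists_cover_gauge_lift_q F n K c₀ hε₀ U₀ hreg u q x h y₀
  -- scales
  set ℓ : ℝ := (F.L : ℝ) ^ (K - n) with hℓ
  have hL1 : (1 : ℝ) < (F.L : ℝ) := by exact_mod_cast F.hL.2
  have hL0 : (0 : ℝ) < (F.L : ℝ) := lt_trans zero_lt_one hL1
  have hℓpos : 0 < ℓ := pow_pos hL0 _
  have hη : 0 < eta F n K := eta_pos F n K
  have hℓη : ℓ * eta F n K = 1 := by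
    rw [hℓ]; unfold eta; rw [← mul_pow, mul_inv_cancel₀ hL0.ne', one_pow]
  have hℓδ : ((F.cover 3).L : ℝ) ^ (K - n) * (48 * ε₀ * eta F n K) ≤ θ₀ := by
    show ℓ * (48 * ε₀ * eta F n K) ≤ θ₀
    calc ℓ * (48 * ε₀ * eta F n K) = 48 * ε₀ * (ℓ * eta F n K) := by ring
      _ = 48 * ε₀ := by rw [hℓη, mul_one]
      _ ≤ θ₀ := by linarith
  have hball : (4 : ℝ) * (F.L : ℝ) ^ (K - n) + 1 ≤ 12 * (F.L : ℝ) ^ (K - n) + 4 := by linarith [hℓpos.le]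
  -- the Hölder letter UPSTAIRS at `(Mu, Mf, Mq, δ) := (M, X, Cq·M, 48ε₀η)`
  have hHö := hHlocV (F.cover 3) n K c₀ V ut qt ft (siteEquiv (F.cover 3) K ct) M X (Cq * M) (48 * ε₀ * eta F n K) hM0 hX (mul_nonneg hCq hM0) (by positivity) hℓδ heq
    (fun z _ => by rw [hut]; exact huM _) (fun z μ _ => by obtain ⟨b, hb⟩ := hft (z, μ); rw [hb]; exact hx b) (fun z _ => by rw [hqt]; exact hqM _)
    (fun z μ hz => hδ z μ (hz.trans hball))
  -- the radius `ℓ / a²`, `a = 8Ch(1+Cq) + 1`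
  set a : ℝ := 8 * Ch * (1 + Cq) + 1 with ha
  have hCC : 0 ≤ Ch * (1 + Cq) := mul_nonneg hCh (by linarith)
  have hCq' : 0 ≤ Ch * Cq := mul_nonneg hCh hCq
  have ha1 : 1 ≤ a := by rw [ha]; linarith
  have ha0 : 0 < a := lt_of_lt_of_le zero_lt_one ha1
  have haℓ : ℓ / a ^ 2 ≤ ℓ := by
    rw [div_le_iff₀ (by positivity)]
    exact le_mul_of_one_le_right hℓpos.le (one_le_pow₀ ha1)
  -- a lift `z` of `y'` at the same distance from `ct`
  obtain ⟨z, hzy, hdz⟩ := hlift y'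
  have hz : tdist (periodsT3 (F.cover 3) K) (siteEquiv (F.cover 3) K ct) z ≤ ℓ / a ^ 2 := by rw [hdz]; exact hy'
  have h1 := hHö z (hz.trans haℓ)
  have h2 : (tdist (periodsT3 (F.cover 3) K) (siteEquiv (F.cover 3) K ct) z / ((F.cover 3).L : ℝ) ^ (K - n)) ^ ((1 : ℝ) / 2) ≤ 1 / a := by
    have hq' : tdist (periodsT3 (F.cover 3) K) (siteEquiv (F.cover 3) K ct) z / ((F.cover 3).L : ℝ) ^ (K - n) ≤ (1 / a) ^ 2 := by
      show tdist (periodsT3 (F.cover 3) K) (siteEquiv (F.cover 3) K ct) z / ℓ ≤ (1 / a) ^ 2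
      rw [div_le_iff₀ hℓpos]
      calc tdist (periodsT3 (F.cover 3) K) (siteEquiv (F.cover 3) K ct) z ≤ ℓ / a ^ 2 := hz
        _ = (1 / a) ^ 2 * ℓ := by field_simp
    calc _ ≤ ((1 / a) ^ 2) ^ ((1 : ℝ) / 2) := Real.rpow_le_rpow (div_nonneg (tdist_nonneg _ _ _) (by positivity)) hq' (by norm_num)
      _ = 1 / a := by rw [← Real.sqrt_eq_rpow, Real.sqrt_sq (by positivity)]
  have h3 : ‖WL2.equiv ℂ (fun _ : TSite 3 (periodsT3 (F.cover 3) K) => c₀) W₂ ut z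
      - WL2.equiv ℂ (fun _ : TSite 3 (periodsT3 (F.cover 3) K) => c₀) W₂ ut (siteEquiv (F.cover 3) K ct)‖ ≤ (M + X) / 8 := by
    have hCa : Ch * (1 + Cq) / a ≤ 1 / 8 := by rw [div_le_iff₀ ha0, ha]; linarith
    have hCa' : Ch / a ≤ 1 / 8 := by rw [div_le_iff₀ ha0, ha]; linarith
    calc _ ≤ Ch * (M + X + Cq * M) * (tdist (periodsT3 (F.cover 3) K) (siteEquiv (F.cover 3) K ct) z / ((F.cover 3).L : ℝ) ^ (K - n)) ^ ((1 : ℝ) / 2) := h1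
      _ ≤ Ch * (M + X + Cq * M) * (1 / a) := mul_le_mul_of_nonneg_left h2 (by positivity)
      _ = M * (Ch * (1 + Cq) / a) + X * (Ch / a) := by ring
      _ ≤ M * (1 / 8) + X * (1 / 8) := add_le_add (mul_le_mul_of_nonneg_left hCa hM0) (mul_le_mul_of_nonneg_left hCa' hX)
      _ = (M + X) / 8 := by ring
  -- `‖u y'‖ = ‖ũ z‖ ≥ ‖ũ(ẽ ct)‖ − (M+X)/8 = M − (M+X)/8`
  have hct : ‖WL2.equiv ℂ (fun _ : TSite 3 (periodsT3 (F.cover 3) K) => c₀) W₂ ut (siteEquiv (F.cover 3) K ct)‖ = M := by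
    rw [hut, Equiv.symm_apply_apply, hcty, hy₀]
  have hzval : ‖WL2.equiv ℂ (fun _ : TSite 3 (periodsT3 (F.cover 3) K) => c₀) W₂ ut z‖ = ‖WL2.equiv ℂ (fun _ : TSite 3 (periodsT3 F K) => c₀) W₂ u y'‖ := by
    rw [hut, hzy]
  have h4 : ‖WL2.equiv ℂ (fun _ : TSite 3 (periodsT3 (F.cover 3) K) => c₀) W₂ ut (siteEquiv (F.cover 3) K ct)‖
      - ‖WL2.equiv ℂ (fun _ : TSite 3 (periodsT3 (F.cover 3) K) => c₀) W₂ ut z‖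
      ≤ ‖WL2.equiv ℂ (fun _ : TSite 3 (periodsT3 (F.cover 3) K) => c₀) W₂ ut z
        - WL2.equiv ℂ (fun _ : TSite 3 (periodsT3 (F.cover 3) K) => c₀) W₂ ut (siteEquiv (F.cover 3) K ct)‖ := by
    calc _ ≤ ‖WL2.equiv ℂ (fun _ : TSite 3 (periodsT3 (F.cover 3) K) => c₀) W₂ ut (siteEquiv (F.cover 3) K ct)
          - WL2.equiv ℂ (fun _ : TSite 3 (periodsT3 (F.cover 3) K) => c₀) W₂ ut z‖ := norm_sub_norm_le _ _
      _ = _ := norm_sub_rev _ _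
  rw [← hzval]
  linarith

include hCh hHlocV in
/-- ★★★ **DOOR-Q — THE SUP OF A SOLUTION OF `Δ^η_{U₀}u + q = D*_{U₀}x` AT A PRINTED-REGULAR BACKGROUND** ([Balaban1985BackgroundPropagators] Thm 3.1 (3.46)-type; ★CHAIR №62∕№63 (2)).  From the
curved interior η-½-Hölder letter `hHlocV Ch θ₀` (px19 g16 text 857ccd79b0071bdc VERBATIM), for `RegPr F n K ε₀ U₀` with `0 ≤ ε₀ ≤ θ₀∕48`, fields `(u, q, x)` with `Δ^η_{U₀}u + q = D*_{U₀}x`,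
`‖x(b)‖ ≤ X`, the RELATIVE letter `hq` (`‖u‖_∞ ≤ G_b ⇒ ‖q‖_∞ ≤ Cq·G_b`, px13's `hPen` shape) and the `L²` ball row `hL2` DOWNSTAIRS (`Σ_{tdist(y₀,·) ≤ ℓ} ‖u‖² ≤ C_A·ℓ³·X²` at every
centre): **`‖u(y)‖ ≤ (2(8Ch(1+Cq)+1)³√C_A + 1)·X`** at every site (`lower_bound_of_hHlocV_q` at the argmax, then `sup_le_of_lower_bound_L2`).  INSTANCES: `hWsup` (`q := 1•w`, `Cq := 1`,
`hL2 :=` ✓(A-ROW)) and `hUsup` (`q := a•T(ι(Q″u))`, `hq :=` ✓`hPen_of_regPr` at `g := u`, `hL2 :=` (β-L²)).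
[cite: Balaban1985BackgroundPropagators, Thm 3.1 (3.46) p.398, p.399 L1-3, (3.35) p.396; Balaban1984PropagatorsII, Lemma 2.1 (2.61)-(2.63) p.234] -/
theorem sup_le_of_hHlocV_q {ε₀ : ℝ} (hε₀ : 0 ≤ ε₀) (hεθ : ε₀ ≤ θ₀ / 48)
    (U₀ : GaugeField (F.P K) 0 (Matrix.specialUnitaryGroup (Fin 2) ℂ)) (hreg : RegPr F n K ε₀ U₀)
    (u q : SiteL2K ℂ 3 (periodsT3 F K) c₀ W₂) (x : BondL2K ℂ 3 (periodsT3 F K) c₀ W₂) (X Cq C_A : ℝ) (hX : 0 ≤ X) (hCq : 0 ≤ Cq) (hCA : 0 ≤ C_A)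
    (h : covLapSite F n K c₀ U₀ u + q = DstarL2 F n K c₀ U₀ x)
    (hx : ∀ b, ‖WL2.equiv ℂ (fun _ : Bond 3 (periodsT3 F K) => c₀) W₂ x b‖ ≤ X)
    (hq : ∀ Gb : ℝ, 0 ≤ Gb → (∀ y : TSite 3 (periodsT3 F K), ‖WL2.equiv ℂ (fun _ : TSite 3 (periodsT3 F K) => c₀) W₂ u y‖ ≤ Gb) →
      ∀ y : TSite 3 (periodsT3 F K), ‖WL2.equiv ℂ (fun _ : TSite 3 (periodsT3 F K) => c₀) W₂ q y‖ ≤ Cq * Gb)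
    (hL2 : ∀ y₀ : TSite 3 (periodsT3 F K),
      ∑ y ∈ Finset.univ.filter (fun y => tdist (periodsT3 F K) y₀ y ≤ (F.L : ℝ) ^ (K - n)),
          ‖WL2.equiv ℂ (fun _ : TSite 3 (periodsT3 F K) => c₀) W₂ u y‖ ^ 2 ≤ C_A * ((F.L : ℝ) ^ (K - n)) ^ 3 * X ^ 2) :
    ∀ y : TSite 3 (periodsT3 F K), ‖WL2.equiv ℂ (fun _ : TSite 3 (periodsT3 F K) => c₀) W₂ u y‖ ≤ (2 * (8 * Ch * (1 + Cq) + 1) ^ 3 * Real.sqrt C_A + 1) * X := by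
  intro y
  classical
  -- the argmax of `‖u‖`
  obtain ⟨y₀, -, hy₀⟩ := Finset.exists_max_image Finset.univ
    (fun y : TSite 3 (periodsT3 F K) => ‖WL2.equiv ℂ (fun _ : TSite 3 (periodsT3 F K) => c₀) W₂ u y‖) ⟨y, Finset.mem_univ _⟩
  set M : ℝ := ‖WL2.equiv ℂ (fun _ : TSite 3 (periodsT3 F K) => c₀) W₂ u y₀‖ with hMdef
  have huM : ∀ y', ‖WL2.equiv ℂ (fun _ : TSite 3 (periodsT3 F K) => c₀) W₂ u y'‖ ≤ M := fun y' => hy₀ y' (Finset.mem_univ _)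
  refine (huM y).trans ?_
  have hM0 : 0 ≤ M := norm_nonneg _
  have hCC : 0 ≤ Ch * (1 + Cq) := mul_nonneg hCh (by linarith)
  exact sup_le_of_lower_bound_L2 F n K c₀ u y₀ M X C_A (8 * Ch * (1 + Cq) + 1) hX hCA (by linarith)
    (lower_bound_of_hHlocV_q Ch θ₀ hCh hHlocV F n K c₀ hε₀ hεθ U₀ hreg u q x y₀ M X Cq hX hCq h huM rfl hx (hq M hM0 huM)) (hL2 y₀)

end Door

end Summit.QuantumFields.YangMills.Theorems.Prop7DivergenceSupDoorQ

end
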